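import Literature.Barriers.CriticalPhenomena.LiouvilleRigidity
import Literature.Geometry.Conformal.Liouville
import HarnessLib

/-!
# Liouville rigidity, proved: `LiouvilleRigidity_holds`

Topic `Literature/Barriers/CriticalPhenomena`; companion of `LiouvilleRigidity`, which vendors
Benedetti–Petronio 1992, Thm A.3.7 (Liouville: for `n ≥ 3` every conformal diffeomorphism between
domains of `ℝⁿ` has the form `x ↦ λ A i(x) + b`, `λ > 0`, `A ∈ O(n)`, `i` the identity or an
inversion, `b ∈ ℝⁿ`) as the named fact `Literature.Barriers.CriticalPhenomena.LiouvilleRigidity`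
for `EuclideanSpace ℝ (Fin n)`.

The theorem itself is PROVED in the tree, for every real inner product space `E` with
`3 ≤ finrank ℝ E < ∞`, as `Literature.Geometry.Conformal.liouville`
(`Literature/Geometry/Conformal/Liouville.lean`, following the printed proof, Steps 1–4,
pp. 21–25). This file discharges the named fact by specialisation:

* `E = EuclideanSpace ℝ (Fin n)` has `finrank ℝ E = n` (`finrank_euclideanSpace_fin`), so `3 ≤ n`
  is the dimension hypothesis of `liouville`;
* `ConformalAt f x` is `IsConformalMap (fderiv ℝ f x)` (Mathlib
  `conformalAt_iff_isConformalMap_fderiv`);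
* the linear isometry `A : E →ₗᵢ[ℝ] E` produced by `liouville` is upgraded to the linear isometry
  equivalence `A : E ≃ₗᵢ[ℝ] E` asked for by the fact (`LinearIsometry.toLinearIsometryEquiv`,
  finite dimension), with the same underlying map;
* the two disjuncts (`x ↦ c • A x + b`; `x ↦ c • A (inversion x₀ r x) + b` with `x₀ ∉ U`,
  `0 < r`) are those of `liouville` up to the order of the conjuncts.

The injectivity hypothesis `Set.InjOn f U` of `LiouvilleRigidity` is not used.

## References

* R. Benedetti, C. Petronio, *Lectures on Hyperbolic Geometry*, Universitext, Springer 1992,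
  Thm A.3.7 (p. 21), proof pp. 21–25 [BenedettiPetronio1992].
-/

noncomputable section

namespace Literature.Barriers.CriticalPhenomena

/-- **Liouville's rigidity theorem holds** (Benedetti–Petronio 1992, Thm A.3.7, for `ℝⁿ`,
`n ≥ 3`): the named fact `LiouvilleRigidity` follows from the tree's proof
`Literature.Geometry.Conformal.liouville` of that theorem (any real inner product space of finite
dimension `≥ 3`), specialised to `EuclideanSpace ℝ (Fin n)` (`finrank = n`), with
`ConformalAt f x ↔ IsConformalMap (fderiv ℝ f x)` and the linear isometry of the conclusion
upgraded to a linear isometry equivalence (finite dimension). The injectivity hypothesis is not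
used. [cite: BenedettiPetronio1992, Thm. A.3.7 (p. 21)] -/
theorem LiouvilleRigidity_holds : LiouvilleRigidity := by
  intro n hn U f hU hUc hf _ hconf
  have h3 : 3 ≤ Module.finrank ℝ (EuclideanSpace ℝ (Fin n)) := by
    rwa [finrank_euclideanSpace_fin]
  have hconf' : ∀ x ∈ U, IsConformalMap (fderiv ℝ f x) := fun x hx =>
    conformalAt_iff_isConformalMap_fderiv.1 (hconf x hx)
  obtain ⟨c, A, b, hc, h⟩ := Literature.Geometry.Conformal.liouville h3 hU hUc hf hconf'
  refine ⟨c, A.toLinearIsometryEquiv rfl, b, hc, ?_⟩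
  rcases h with h | ⟨x₀, r, hx₀, hr, h⟩
  · exact Or.inl fun x hx => h hx
  · exact Or.inr ⟨x₀, r, hr, hx₀, fun x hx => h hx⟩

end Literature.Barriers.CriticalPhenomena

end
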